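import Literature.MathematicalPhysics.QuantumFieldTheory.Balaban1983to89.Node00.Record12BgRowMixed

/-!
# NODE 00 — ROW P11: THE CO-DIVERGENCE MEMBER (1.9) OF [6]'s REGULAR SPACE `U_k({Ω_j}, α₀)` — `|(D^{η*}_U ∂U)(b)| < α₀L^{−2j}(L^jη)^{−1}` —
# typed at the record (`Sect2.coDivSum`, `Sect2.CoDivSmallOn`, `Sect2.CoDivClassOn`), and the [15] fact with print's full class (2) = (1.7)+(1.9)

Cell `pub-ymgap`, seat `pub-ymgap-node00-def-P11` g2 (R218; director-ym №143 (a) «def-P11 types `Sect2.CoDivSmallOn`»; node00-def-R ANSWER-143 INBOX l.17417 «evaluate it at the MINIMISER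
`UbgMSOfRecord … s W` — the v1.3 guard `h9`»; HYP-AUDIT-13 row H4 ∕ located №6).  [6] = [Balaban1985RegularSpaces] pp.76–77 (renders `…cmp99…-p002∕p003-x2.png`); [15] = [Balaban1985Variational] p.278 (2).

HONEST FRAMING.  Typing + bookkeeping: print's co-derivative of the plaquette field and the smallness clause it enters, as DISPLAYED predicates; one more named fact (a `Prop`, never
asserted) whose minimiser hypothesis carries print's FULL class (2); nothing of Bałaban asserted or discharged; K0⁗ NOT closed; counts unmoved (28∕28 · 5∕28); finite `𝕋⁴`; not continuum ∕ OS ∕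
mass gap ∕ Clay.  `SU(N)` model of record (the co-derivative is a SUM of matrices: it needs the algebra `M_N(ℂ)`, r11's `MatA`∕`ιSU`).  Four `def`s, no `instance`, no `sorry`.

PRINT.  [6] p.76 (1.1): «(D^η_{U,μ}F)(x) = η⁻¹(R(U(x, x+ηe_μ))F(x+ηe_μ) − F(x)), (D^{η*}_{U,μ}F)(x) = η⁻¹(R(U(x, x−ηe_μ))F(x−ηe_μ) − F(x)), R(U)X = UXU⁻¹»; (1.2): for `F` on plaquettes,
`F_{μν}(x) = F(p_{μν}(x))`, `p_{μν}(x) = ⟨x, x+ηe_μ, x+ηe_μ+ηe_ν, x+ηe_ν⟩` (μ < ν): «(D^{η*}_U F)(x, x+ηe_μ) = (D^{η*}_U F)_μ(x) = Σ_{ν<μ} (D^{η*}_{U,ν}F_{νμ})(x) − Σ_{ν>μ} (D^{η*}_{U,ν}F_{μν})(x)»; p.77 (1.9):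
«|(D^{η*}_U ∂U)(b)| < α₀L^{−2j}(L^jη)^{−1} for b ∈ Ω_j, j = 0, 1, …, k» (with (1.7) `|U(∂p) − 1| < α₀L^{−2j}` for `p ∈ Ω_j`; «Ω also denotes the set of bonds with at least one end-point in Ω»); [15] (2) =
(1.7)+(1.9) at `ε₀`: «|(D^{η*}_U ∂U)(b)| < ε₀L^{−2j}(L^jη)^{−1} = ε₀η²(L^jη)^{−3} for b ∈ Ω_j».  AT THE RECORD (fine lattice = level 0, `η_j = L^{−j}`, unit fine spacing): `U(x, x−e_ν) = U⟨x−e_ν, ν⟩⁻¹`,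
so `R(U(x, x−e_ν))F(x−e_ν) = U⟨x−e_ν,ν⟩⁻¹·F(x−e_ν)·U⟨x−e_ν,ν⟩`; the `η⁻¹` prefactor is moved into the threshold: (1.9) ⟺ `‖η·(D^{η*}_U∂U)(b)‖ < α₀·η_j³` — `Sect2.coDivSum` is `η·D^{η*}_U ∂U`, the threshold
`ε·η_j³`.

CONTENTS.  §1 `Sect2.plaqAtBack` bookkeeping, ★ `Sect2.coDivSum U x μ : MatA N` ((1.2) for `F = ∂U`, η-free), ★ `Sect2.CoDivSmallOn S δ U` ((1.9) on a bond set), ★ `Sect2.CoDivClassOn Ω k ε U` (the (1.9)-half of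
`U_k({Ω_j}, ε)`: `∀ j ≤ k`, bonds meeting `Ω_j` — all bonds at `j = 0` —, threshold `ε·η_j³`; the (1.7)-half is def-R's `regMSOfRecord`∕`omegaPlaqs`), `CoDivClassOn.of_le`.  §2 `IsMinimizer.of_subset_of_mem` (def-R's one-liner: a
minimiser over a class that lies in a sub-class minimises over the sub-class).  §3 ★★ `VariationalThm1RegSepPrintedCo` — [15] Thm 1 (R) with the minimiser ranging over the (1.7)-class AND satisfying (1.9) at `ε₀` (= print's (6)), data (7) on
the CONCORD range, separated, comparable; conclusion = (8)'s two members at `B₃δ_n` (plaquettes `B₃δ_nη_n²`, co-divergence `B₃δ_nη_n³`); `VariationalThm1RegSepPrinted → …Co` (the (1.7)-only fact is the STRONGER statement).  §4 suppliers: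
★ `plaqSmallOn_UbgMSOfRecord_of_thm1RegSepPrintedCo (h15) … (h7) (h9 : Sect2.CoDivClassOn s.Ω k ν.εreg (UbgMSOfRecord … s W)) (hsol)`, ★★★ `bgRowAtDatum_of_thm1RegSepPrintedCoC1` (the row's body at `(s, 𝐖)` with `h9` =
def-R's v1.3 guard conjunct evaluated AT THE MINIMISER).

DEPENDENCES (by name): `Site.unshift`, `GaugeField.plaqHol`, `Record11.(MatA, ιSU)`, `B15DeterminingSets.(bondsOf, IsMinimizer)`, def-R `UbgMSOfRecord`∕`isMinimizer_UbgMSOfRecord`∕`regMSOfRecord`∕`omegaPlaqs`, FILE 8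
`Sect2.DataSmall7P`, `Sect2.SeqSeparated`, `bgRowAtDatum_of_classBoundsC1`, FILE 7c letters.
-/

noncomputable section

open MeasureTheory
open scoped Matrix.Norms.L2Operator

namespace Literature.MathematicalPhysics.QuantumFieldTheory.Balaban1983to89.Node00

open T4Continuum B14.Eq218Concrete B15DeterminingSets B12RegularSpaces111 B14RegularSpaces234 B14Radii T4AxialGaugeSmallField

/-! ## §1  The co-derivative `D^{η*}_U ∂U` at a bond ([6] (1.1)–(1.2)) and the clause (1.9) -/

section CoDiv

variable {P : Params} {j : ℕ} {N : ℕ} [NeZero N]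

/-- The embedded plaquette variable `(∂U)(p_{μν}(x))`, `μ < ν`, as a matrix. [cite: Balaban1985RegularSpaces, (1.2) p.76 (bookkeeping)] -/
def Sect2.plaqMat (U : GaugeField P j (SU N)) (x : Site P j) (μ ν : Fin P.d) (h : μ < ν) : MatA N :=
  ((ιSU N (GaugeField.plaqHol U ⟨x, μ, ν, h⟩) : (MatA N)ˣ) : MatA N)

/-- One term of (1.2): `η·(D^{η*}_{U,ν} F_{αβ})(x) = R(U(x, x−e_ν)) F_{αβ}(x−e_ν) − F_{αβ}(x)` with `R(U(x, x−e_ν))X = U⟨x−e_ν, ν⟩⁻¹·X·U⟨x−e_ν, ν⟩` (`U(x, x−e_ν) = U(x−e_ν, x)⁻¹`).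
[cite: Balaban1985RegularSpaces, (1.1)–(1.2) p.76] -/
def Sect2.coDivTerm (U : GaugeField P j (SU N)) (x : Site P j) (ν α β : Fin P.d) (h : α < β) : MatA N :=
  ((ιSU N (U ⟨x.unshift ν, ν⟩)⁻¹ : (MatA N)ˣ) : MatA N) * Sect2.plaqMat U (x.unshift ν) α β h * ((ιSU N (U ⟨x.unshift ν, ν⟩) : (MatA N)ˣ) : MatA N) -
    Sect2.plaqMat U x α β h

/-- **`η·(D^{η*}_U ∂U)(x, x+e_μ)`** ([6] (1.2) for `F = ∂U`, the prefactor `η⁻¹` moved to the threshold): `Σ_{ν<μ} [R(U(x,x−e_ν))(∂U)(p_{νμ}(x−e_ν)) − (∂U)(p_{νμ}(x))] −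
Σ_{ν>μ} [R(U(x,x−e_ν))(∂U)(p_{μν}(x−e_ν)) − (∂U)(p_{μν}(x))]` — the covariant CO-DIVERGENCE of the plaquette field at the bond `⟨x, x+e_μ⟩` (the lattice Yang–Mills current), a sum of
matrices in `M_N(ℂ)`. [cite: Balaban1985RegularSpaces, (1.1)–(1.2) p.76, (1.9) p.77] -/
def Sect2.coDivSum (U : GaugeField P j (SU N)) (x : Site P j) (μ : Fin P.d) : MatA N :=
  ∑ ν : Fin P.d, if h : ν < μ then Sect2.coDivTerm U x ν ν μ h else if h' : μ < ν then -Sect2.coDivTerm U x ν μ ν h' else 0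

/-- **(1.9) ON A BOND SET** (η-free normalisation): `‖η·(D^{η*}_U ∂U)(b)‖ < δ` for `b ∈ S`. [cite: Balaban1985RegularSpaces, (1.9) p.77; Balaban1985Variational, (2) p.278] -/
def Sect2.CoDivSmallOn (S : Set (PBond P j)) (δ : ℝ) (U : GaugeField P j (SU N)) : Prop :=
  ∀ b ∈ S, ‖Sect2.coDivSum U b.src b.dir‖ < δ

/-- Weakening the threshold. [cite: Balaban1985RegularSpaces, (1.9) p.77 (bookkeeping)] -/
theorem Sect2.CoDivSmallOn.of_le {S : Set (PBond P j)} {δ δ' : ℝ} {U : GaugeField P j (SU N)} (h : Sect2.CoDivSmallOn S δ U) (hδ : δ ≤ δ') :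
    Sect2.CoDivSmallOn S δ' U := fun b hb => (h b hb).trans_le hδ

/-- Shrinking the bond set. [cite: Balaban1985RegularSpaces, (1.9) p.77 (bookkeeping)] -/
theorem Sect2.CoDivSmallOn.mono {S T : Set (PBond P j)} {δ : ℝ} {U : GaugeField P j (SU N)} (h : Sect2.CoDivSmallOn T δ U) (hST : S ⊆ T) :
    Sect2.CoDivSmallOn S δ U := fun b hb => h b (hST hb)

end CoDiv

section CoDivClass

variable {P : Params} {N : ℕ} [NeZero N]

/-- The bond set of (1.9) at scale `j` for a sequence `{Ω_j}` (p.77: «Ω also denotes the set of bonds with at least one end-point in Ω»; `Ω₀ = T_η`: every bond at `j = 0`, as def-R's `omegaPlaqs`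
does for plaquettes). [cite: Balaban1985RegularSpaces, (1.3)–(1.9) p.77] -/
def Sect2.omegaBonds (Ω : ℕ → Set (Site P 0)) (j : ℕ) : Set (PBond P 0) :=
  if j = 0 then Set.univ else bondsOf (Ω j)

/-- **THE (1.9)-HALF OF THE REGULAR SPACE `U_k({Ω_j}, ε)`** at the record: for every `j ≤ k`, `‖η·(D^{η*}_U ∂U)(b)‖ < ε·η_j³` on the bonds meeting `Ω_j` (print: `< εL^{−2j}(L^jη)^{−1}`, i.e. `η⁻¹·(…) <
ε·η_j²·η_j·η⁻¹` in fine units `η = 1`).  The (1.7)-half is def-R's `regMSOfRecord`∕`omegaPlaqs` (`ε·η_j²`); print's class (2)∕(6) = both; the record's (2.12) class carries (1.7) only (HYP-AUDIT-13 №6,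
def-R D-defB-1) — this predicate is the missing member, to be read AT THE MINIMISER in the v1.3 support guard (def-R ANSWER-143). [cite: Balaban1985RegularSpaces, (1.7)–(1.9) p.77; Balaban1985Variational, (2) p.278] -/
def Sect2.CoDivClassOn (Ω : ℕ → Set (Site P 0)) (k : ℕ) (ε : ℝ) (U : GaugeField P 0 (SU N)) : Prop :=
  ∀ j, j ≤ k → Sect2.CoDivSmallOn (Sect2.omegaBonds Ω j) (ε * P.eta j ^ 3) U

/-- Weakening the threshold of the class (`0 ≤ η_j³`). [cite: Balaban1985RegularSpaces, (1.9) p.77 (bookkeeping)] -/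
theorem Sect2.CoDivClassOn.of_le {Ω : ℕ → Set (Site P 0)} {k : ℕ} {ε ε' : ℝ} {U : GaugeField P 0 (SU N)} (h : Sect2.CoDivClassOn Ω k ε U) (hε : ε ≤ ε') :
    Sect2.CoDivClassOn Ω k ε' U := fun j hj =>
  (h j hj).of_le (mul_le_mul_of_nonneg_right hε (pow_nonneg (pow_pos (inv_pos.mpr (Nat.cast_pos.mpr P.L_pos)) j).le 3))

end CoDivClass

/-! ## §2  A minimiser over a class that lies in a sub-class minimises over the sub-class (node00-def-R ANSWER-143's one-liner) -/

section Minimiser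

variable {P : Params} {G : Type*} [GaugeGroup G]

/-- **`IsMinimizer.of_subset_of_mem`**: if `U₀` minimises over `reg` on the fibre of `V` and lies in `reg' ⊆ reg`, it minimises over `reg'` — how a minimiser of record over the (1.7)-class that
satisfies (1.9) becomes a minimiser over print's class (6). [cite: Balaban1985Variational, (6) p.278 (bookkeeping); Balaban1988Convergent, (2.12) p.256] -/
theorem IsMinimizer.of_subset_of_mem {av : ∀ j, Averaging P j G} {reg reg' : Set (GaugeField P 0 G)} {𝔹 : DetSet P} {V : MSField P G} {U₀ : GaugeField P 0 G}
    (hsub : reg' ⊆ reg) (hmem : U₀ ∈ reg') (h : IsMinimizer av reg 𝔹 V U₀) : IsMinimizer av reg' 𝔹 V U₀ :=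
  ⟨hmem, h.2.1, fun U hU hUV => h.2.2 U (hsub hU) hUV⟩

end Minimiser

/-! ## §3  ★★ [15] Thm 1 (R) with print's FULL class (2) = (1.7)+(1.9) on the minimiser, data (7) on the CONCORD range -/

section NamedFactCo

variable (F : T4Family) (N : ℕ) [NeZero N]

/-- **★★ [15] THEOREM 1, (R), per scale, print's sequences, print's data (7) (CONCORD range), PRINT'S CLASS (2) = (1.7)+(1.9) ON THE MINIMISER** (NAMED FACT, never asserted; constants as
parameters): for a separated `s`, thresholds `0 < δ_n ≤ a₁`, `B₃δ_n ≤ ε₀ ≤ a₀`, comparable, a datum with `Sect2.DataSmall7P … δ W`, and a minimiser `U₀` of (2.12) over the (1.7)-class of threshold `ε₀` that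
ALSO satisfies the co-divergence member (1.9) at `ε₀` (`Sect2.CoDivClassOn s.Ω k ε₀ U₀` — so `U₀` lies in print's class (6) and, by `IsMinimizer.of_subset_of_mem`, minimises over it; print: «a unique critical orbit
in the space (6)», hence the minimal orbit (8)): `U₀ ∈ U_k({Ω_j}, B₃δ)` — plaquettes `|U₀(∂p) − 1| < B₃δ_n·η_n²` on `omegaPlaqs s.Ω n` AND co-divergence `< B₃δ_n·η_n³` on `omegaBonds s.Ω n`, every `n ≤ k`.
WEAKER than `VariationalThm1RegSepPrinted` (one more hypothesis) — `VariationalThm1RegSepPrinted.toCo_plaq` gives its plaquette half.  This is the sentence of record for HYP-AUDIT-13 row H4 (director №143 (a),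
def-R ANSWER-143): with `h9` read at the minimiser, the row asserts exactly Thm 1's conclusion for print's own minimiser.
-- TODO(general form): ONE threshold ε₁ in print; general admissible `{Ω_j}`∕`𝔅_k`; (9)–(10) on class cubes are NOT part of this fact (C¹ route displays `PlaqC1SmallOn` separately).
[cite: Balaban1985Variational, Thm 1 (2),(6),(7)–(8) pp.278–279; Balaban1985RegularSpaces, (1.1)–(1.2) p.76, (1.3)–(1.9) p.77; Balaban1988Convergent, (2.7)–(2.8) pp.255–256, (2.12) p.256, p.259] -/
def VariationalThm1RegSepPrintedCo (B₃ a₀ a₁ : ℝ) : Prop :=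
  ∀ (ν : Stage7Numerics) (M : ℕ) (g : ℕ → ℝ) (K k : ℕ) (s : SeqOfRecord F ν M g K k), Sect2.SeqSeparated ν.M₁ s → ∀ (ε₀ : ℝ) (δ : ℕ → ℝ),
    (∀ n, n ≤ k → 0 < δ n ∧ δ n ≤ a₁ ∧ B₃ * δ n ≤ ε₀) → (∀ n, n < k → δ n ≤ 2 * δ (n + 1)) → ε₀ ≤ a₀ →
    ∀ W : MSField (F.P K) (SU N), Sect2.DataSmall7P (avOfRecord F N K) s.Ω k δ W →
      ∀ U₀, IsMinimizer (avOfRecord F N K) {U | ∀ n, n ≤ k → PlaqSmallOn (omegaPlaqs s.Ω n) (ε₀ * (F.P K).eta n ^ 2) U} (genSet s.Ω k) W U₀ →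
        Sect2.CoDivClassOn s.Ω k ε₀ U₀ →
        (∀ n, n ≤ k → PlaqSmallOn (omegaPlaqs s.Ω n) (B₃ * δ n * (F.P K).eta n ^ 2) U₀) ∧
          ∀ n, n ≤ k → Sect2.CoDivSmallOn (Sect2.omegaBonds s.Ω n) (B₃ * δ n * (F.P K).eta n ^ 3) U₀

end NamedFactCo

/-! ## §4  Suppliers: the class bound at def-R's background for a (7)-regular datum whose minimiser satisfies (1.9); the row's body per datum -/

section Suppliers

variable {F : T4Family} {N : ℕ} [NeZero N]

/-- **★ DEF-R'S BACKGROUND IS `B₃·cR·ε_n`-REGULAR AT EVERY SCALE** for a separated sequence, comparable thresholds, a datum with print's (7) (CONCORD range, thresholds `cR·ε_n`), a solvable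
fibre, and the record's minimiser satisfying the co-divergence member (1.9) at the class threshold `εreg` (`h9` — def-R ANSWER-143's v1.3 guard conjunct, read AT THE MINIMISER). [cite: Balaban1985Variational, Thm 1 (2),(7)–(8) pp.278–279; Balaban1985RegularSpaces, (1.9) p.77; Balaban1988Convergent, (2.12) p.256, p.259] -/
theorem plaqSmallOn_UbgMSOfRecord_of_thm1RegSepPrintedCo {B₃ a₀ a₁ : ℝ} (h15 : VariationalThm1RegSepPrintedCo F N B₃ a₀ a₁) (ν : Stage7Numerics) (M : ℕ)
    (g : ℕ → ℝ) (K k : ℕ) (cR : ℝ) (s : SeqOfRecord F ν M g K k) (hsep : Sect2.SeqSeparated ν.M₁ s)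
    (hnum : ∀ n, n ≤ k → 0 < cR * epsOfRecord ν g n ∧ cR * epsOfRecord ν g n ≤ a₁ ∧ B₃ * (cR * epsOfRecord ν g n) ≤ ν.εreg) (ha₀ : ν.εreg ≤ a₀)
    (hcomp : ∀ n, n < k → cR * epsOfRecord ν g n ≤ 2 * (cR * epsOfRecord ν g (n + 1)))
    {W : MSField (F.P K) (SU N)} (h7 : Sect2.DataSmall7P (avOfRecord F N K) s.Ω k (fun n => cR * epsOfRecord ν g n) W)
    (h9 : Sect2.CoDivClassOn s.Ω k ν.εreg (UbgMSOfRecord F N ν M g K k s W))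
    (hsol : W ∈ solvableDom (avOfRecord F N K) (regMSOfRecord F N ν K k s.Ω) (genSet s.Ω k)) :
    ∀ n, n ≤ k → PlaqSmallOn (omegaPlaqs s.Ω n) (B₃ * (cR * epsOfRecord ν g n) * (F.P K).eta n ^ 2) (UbgMSOfRecord F N ν M g K k s W) :=
  (h15 ν M g K k s hsep ν.εreg (fun n => cR * epsOfRecord ν g n) hnum hcomp ha₀ W h7 _ (isMinimizer_UbgMSOfRecord ν M g K k s hsol) h9).1

/-- The co-divergence half of the conclusion at def-R's background (print's (8) second member at `B₃·cR·ε_n·η_n³`). [cite: Balaban1985Variational, Thm 1 (8) p.279; Balaban1985RegularSpaces, (1.9) p.77] -/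
theorem coDivSmallOn_UbgMSOfRecord_of_thm1RegSepPrintedCo {B₃ a₀ a₁ : ℝ} (h15 : VariationalThm1RegSepPrintedCo F N B₃ a₀ a₁) (ν : Stage7Numerics) (M : ℕ)
    (g : ℕ → ℝ) (K k : ℕ) (cR : ℝ) (s : SeqOfRecord F ν M g K k) (hsep : Sect2.SeqSeparated ν.M₁ s)
    (hnum : ∀ n, n ≤ k → 0 < cR * epsOfRecord ν g n ∧ cR * epsOfRecord ν g n ≤ a₁ ∧ B₃ * (cR * epsOfRecord ν g n) ≤ ν.εreg) (ha₀ : ν.εreg ≤ a₀)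
    (hcomp : ∀ n, n < k → cR * epsOfRecord ν g n ≤ 2 * (cR * epsOfRecord ν g (n + 1)))
    {W : MSField (F.P K) (SU N)} (h7 : Sect2.DataSmall7P (avOfRecord F N K) s.Ω k (fun n => cR * epsOfRecord ν g n) W)
    (h9 : Sect2.CoDivClassOn s.Ω k ν.εreg (UbgMSOfRecord F N ν M g K k s W))
    (hsol : W ∈ solvableDom (avOfRecord F N K) (regMSOfRecord F N ν K k s.Ω) (genSet s.Ω k)) :
    ∀ n, n ≤ k → Sect2.CoDivSmallOn (Sect2.omegaBonds s.Ω n) (B₃ * (cR * epsOfRecord ν g n) * (F.P K).eta n ^ 3) (UbgMSOfRecord F N ν M g K k s W) :=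
  (h15 ν M g K k s hsep ν.εreg (fun n => cR * epsOfRecord ν g n) hnum hcomp ha₀ W h7 _ (isMinimizer_UbgMSOfRecord ν M g K k s hsol) h9).2

/-- **★★★ ROW P11's BODY AT `(s, 𝐖)` FROM THE FULL-CLASS FACT** — `bgRowAtDatum_of_classBoundsC1` fed by `VariationalThm1RegSepPrintedCo` + the two v1.3 support-guard conjuncts read at the datum ∕ the
minimiser: `h7 : Sect2.DataSmall7P … W` (print's (7)) and `h9 : Sect2.CoDivClassOn s.Ω k εreg (UbgMSOfRecord … s W)` ((1.9) at the minimiser, def-R ANSWER-143) + the displayed C¹ class clause + FILE 7c's letters. [cite: Balaban1985Variational, Thm 1 (7)–(10) pp.278–279; Balaban1985RegularSpaces, (1.3)–(1.9) p.77; Balaban1988Convergent, (2.4)–(2.8) pp.255–256, (2.27)–(2.28) p.259, (2.34)–(2.41) p.261; Balaban1987RG1, (1.11)–(1.16) p.262] -/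
theorem bgRowAtDatum_of_thm1RegSepPrintedCoC1 {B₃ B₃' a₀ a₁ tI tMS : ℝ} (h15 : VariationalThm1RegSepPrintedCo F N B₃ a₀ a₁)
    (S : Sect2.Setting (MatA N) (SU N)) (hι : S.ι = ιSU N) (h𝓜 : S.𝓜 = B12RegularSpaces111SpecialUnitary.suModel N) (hS : S.Laws) (hpos : S.Pos)
    (ν : Stage7Numerics) {M : ℕ} (hM : 0 < M) (K k : ℕ) (cR : ℝ) (hB₃ : 0 ≤ B₃) (hB₃' : 0 ≤ B₃')
    (hg : ∀ j, 1 ≤ j → j ≤ k → 0 < S.flow.g j ∧ S.flow.g j ^ 2 ≤ Real.exp (-1)) (hpq : ν.p₀ ≤ S.lf.q₀)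
    (hnum : ∀ n, n ≤ k → 0 < cR * epsOfRecord ν S.flow.g n ∧ cR * epsOfRecord ν S.flow.g n ≤ a₁ ∧ B₃ * (cR * epsOfRecord ν S.flow.g n) ≤ ν.εreg)
    (ha₀ : ν.εreg ≤ a₀) (hcomp : ∀ n, n < k → cR * epsOfRecord ν S.flow.g n ≤ 2 * (cR * epsOfRecord ν S.flow.g (n + 1)))
    (hα : ∀ n, 1 ≤ n → n ≤ k → 0 < S.lf.alpha0 (S.flow.g n) ∧ 0 < S.lf.alpha1 (S.flow.g n))
    (hBα : ∀ n, 1 ≤ n → n ≤ k → B₃ * (cR * epsOfRecord ν S.flow.g n) ≤ (1 - S.βc) * S.lf.alpha0 (S.flow.g n))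
    (hΛI0 : 0 ≤ (4 * (B₃ + (((F.P K).d - 1 : ℕ) : ℝ) * (((F.P K).L : ℝ) * M) * B₃') + 16 * ((((F.P K).d - 1 : ℕ) : ℝ) * (((F.P K).L : ℝ) * M)) ^ 2 * B₃ ^ 2 * a₁) * cR * ν.A₀)
    (hΛI : (4 * (B₃ + (((F.P K).d - 1 : ℕ) : ℝ) * (((F.P K).L : ℝ) * M) * B₃') + 16 * ((((F.P K).d - 1 : ℕ) : ℝ) * (((F.P K).L : ℝ) * M)) ^ 2 * B₃ ^ 2 * a₁) * cR * ν.A₀ ≤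
      tI * S.lf.C₀) (htI : tI < S.cB)
    (hΛMS0 : 0 ≤ (4 * (B₃ + (((F.P K).d - 1 : ℕ) : ℝ) * (M : ℝ) * B₃') + 16 * ((((F.P K).d - 1 : ℕ) : ℝ) * (M : ℝ)) ^ 2 * B₃ ^ 2 * a₁) * cR * ν.A₀)
    (hΛMS : (4 * (B₃ + (((F.P K).d - 1 : ℕ) : ℝ) * (M : ℝ) * B₃') + 16 * ((((F.P K).d - 1 : ℕ) : ℝ) * (M : ℝ)) ^ 2 * B₃ ^ 2 * a₁) * cR * ν.A₀ ≤ tMS * S.lf.C₀)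
    (htMS : tMS < S.B * S.C * S.Mr)
    (hsN : ∀ n, 1 ≤ n → n ≤ k + 1 → ((B14.Eq213MaximalDomains.side (F.P K).L M n : ℕ) : ℤ) < (F.P K).sitesPerDir 0)
    (hcB : 2 * (((F.P K).d - 1 : ℕ) : ℝ) * ((F.P K).L * M) < S.cB) (hBCM : 2 * (((F.P K).d - 1 : ℕ) : ℝ) * M < S.B * S.C * S.Mr)
    (hsmallI : ∀ j, 1 ≤ j → j ≤ k → (((F.P K).d - 1 : ℕ) : ℝ) * ((F.P K).L * M) * (F.P K).eta j * (B₃ * (cR * epsOfRecord ν S.flow.g j)) ≤ 1 / 2)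
    (hsmallMS : ∀ n, 1 ≤ n → n ≤ k → (((F.P K).d - 1 : ℕ) : ℝ) * M * (F.P K).eta n * (B₃ * (cR * epsOfRecord ν S.flow.g n)) ≤ 1 / 2)
    (hC1 : ∀ j, 1 ≤ j → j ≤ k → ∃ t : ℕ, 0 < t ∧ RkOfRecord (F.P K).L ν.r (S.flow.g j) = (F.P K).L * t)
    (hC2 : ∀ j, 1 ≤ j → j ≤ k → dCubeSide (F.P K).L M (RkOfRecord (F.P K).L ν.r (S.flow.g j)) j ∣ (F.P K).sitesPerDir 0)
    (s : SeqOfRecord F ν M S.flow.g K k) (hsep : Sect2.SeqSeparated ν.M₁ s) (W : MSField (F.P K) (SU N))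
    (h7 : Sect2.DataSmall7P (avOfRecord F N K) s.Ω k (fun n => cR * epsOfRecord ν S.flow.g n) W)
    (h9 : Sect2.CoDivClassOn s.Ω k ν.εreg (UbgMSOfRecord F N ν M S.flow.g K k s W))
    (hclassC1 : W ∈ solvableDom (avOfRecord F N K) (regMSOfRecord F N ν K k s.Ω) (genSet s.Ω k) →
      ∀ n, 1 ≤ n → n ≤ k →
        PlaqC1SmallOn (plaqInside (s.Ω n)) (B₃' * (cR * epsOfRecord ν S.flow.g n) * (F.P K).eta n ^ 3) (UbgMSOfRecord F N ν M S.flow.g K k s W)) :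
    ∀ j, 1 ≤ j → j ≤ k → ∀ X : (Sect2.domSys (F.P K) M j).Dom,
      (Sect2.domSites (F.P K) M j X ⊆ s.Λ j →
        Sect2.ofBackgroundC S.ι (UbgMSOfRecord F N ν M S.flow.g K k s W) ∈
          Sect2.spaceI S (Sect2.Residual.unit (F.P K) (MatA N)) M j (Sect2.domSites (F.P K) M j X) (S.lf.alpha0 (S.flow.g j)) (S.lf.alpha1 (S.flow.g j))) ∧
      (Sect2.admB (F.P K) ν M S.flow.g s.Ω s.Λ j (Sect2.domSites (F.P K) M j X) = true →
        Sect2.ofBackgroundC S.ι (UbgMSOfRecord F N ν M S.flow.g K k s W) ∈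
          Sect2.spaceMS S (Sect2.Residual.unit (F.P K) (MatA N)) M j (Sect2.domSites (F.P K) M j X) s.Ω) :=
  bgRowAtDatum_of_classBoundsC1 S hι h𝓜 hS hpos ν hM K k (fun n hn => mul_nonneg hB₃ (hnum n hn).1.le) (fun n hn => mul_nonneg hB₃' (hnum n hn).1.le) s W
    (fun hsol => plaqSmallOn_UbgMSOfRecord_of_thm1RegSepPrintedCo h15 ν M S.flow.g K k cR s hsep hnum ha₀ hcomp h7 h9 hsol)
    hclassC1 hα hBα hsN hcB hBCM hsmallI hsmallMS hC1 hC2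
    (hletterI_of_numerics S.lf ν M hg hpq (fun j hj => ⟨(hnum j hj).1, (hnum j hj).2.1⟩) hΛI0 hΛI htI (fun j h1 hj => (hα j h1 hj).1))
    (hletterMS_of_numerics S.lf ν M hg hpq (fun n hn => ⟨(hnum n hn).1, (hnum n hn).2.1⟩) hΛMS0 hΛMS htMS (fun n h1 hn => (hα n h1 hn).1))

end Suppliers

end Literature.MathematicalPhysics.QuantumFieldTheory.Balaban1983to89.Node00

end
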